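import Literature.MathematicalPhysics.QuantumFieldTheory.Dimock2011to13.ResummationOperation
import Literature.MathematicalPhysics.QuantumFieldTheory.Dimock2011to13.ClusterActivityBound

/-!
# Dimock, *The renormalization group according to Balaban* II, Appendix F (`cluster expansion with holes`), proof of
# THEOREM F.1 `\label{cluster3}` — its *"Key ingredients"* (keykey1), (otter) PROVED ((keykey2) by name) for the torus
# `d_M(·, mod Ω^c)` of `…ThreeSortedResummation`, and (simplon) `|K(Y)| ≤ 𝒪(1)H_0e^{−(κ−κ_0−2)d}` obtained by inserting
# them into the App. B kernel `ClusterActivityBound.norm_K_le` (every dimension, every torus)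

**Citation header (reproduction of PUBLISHED work; template of the Bałaban lattice Yang–Mills cell).**
J. Dimock, *The renormalization group according to Balaban II. Large fields*, J. Math. Phys. **54** (2013) 092301
(= arXiv:1212.5562v2) [Dimock2013BalabanII], Appendix F `\section{cluster expansion with holes} \label{fancycluster}`
L6968–7083: THEOREM F.1 `\label{cluster3}` L6984–6997, its proof L7004–7083 — the *"Key ingredients"* (keykey1)
L7007–7011 and (keykey2) L7011–7014, Ω-connectedness L7016–7021, the Mayer expansion L7025–7035, (otter) L7037–7044,
(simplon) L7046–7049; §3.3 `\subsubsection{polymers}` L1676–1705 (𝒟_k(mod Ω^c_k), d_M(X, mod Ω^c_k), (snow)); App. E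
LEMMA E.3 `\label{summit}` (sumsum) L6914–6920.  TeX line numbers refer to the arXiv source held by the cell on this
hub at `run/shared/lean/archive/nearmiss/qft-balaban/dimock/src/1212.5562/1212.5562.tex` (7217 lines, sha256[:16]
75c5792fc48eacbc).  Dimock's papers are published and refereed and are the cell's TEMPLATE, not manuscripts under
audit; no quantity of the Bałaban series is touched.

**What the paper prints (verbatim).**  Proof of THEOREM F.1, L7004–7021: *"This closely follows the proof of the
standard cluster expansion. It is exposed in Appendix B in part I, to which we refer for more details. The differences
are that instead of general polymers X, we have polymers X ∈ 𝒟_k(mod Ω^c) with holes Ω^c, and instead of decay rates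
e^{−κd_M(X)} we have decay rates e^{−κd_k(X, mod Ω^c)} outside the holes. Key ingredients are the bound  Σ_{Y: Y ∩ Y′ ∩ Ω
≠ ∅} e^{−κ_0 d_M(Y, mod Ω^c)} ≤ 𝒪(1)|Y′ ∩ Ω|_M  (keykey1)  from (sumsum) and the bound  |Y′ ∩ Ω|_M ≤ 𝒪(1)(d_M(Y′, mod
Ω^c) + 1)  (keykey2)  We have stated these estimates in a form that takes into account that there is a modified notion
of connectedness between polymers. Now we say that X_1, X_2 ∈ 𝒟_k(mod Ω^c) are Ω-connected if X_1 ∩ Ω and X_2 ∩ Ω have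
non-empty intersection (i.e if X_1 ∩ X_2 ∩ Ω ≠ ∅). Otherwise X_1 ∩ Ω and X_2 ∩ Ω have empty intersection and they are
called Ω-disjoint. Note that Ω-connected implies connected, but Ω-disjoint does not imply disjoint."*  L7031–7044: *"K(Y)
= Σ_{{X_i}: ∪_i X_i = Y} Π_i (e^{H(X_i)} − 1)  The latter sum is restricted by the condition that the X_i are
Ω-connected, i.e. cannot be divided into Ω-disjoint sets. … To estimate K(Y) we need to show that if {X_i} has n
elements  d_M(Y, mod Ω^c) ≤ Σ_i d_M(X_i, mod Ω^c) + (n−1)  (otter)  To see this let τ_i be minimal graphs on the cubes in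
X_i ∩ Ω of length ℓ(τ_i) = M d_M(X_i, mod Ω^c). Stitch together the τ_i to get a graph τ on the cubes in ∪_i (X_i ∩ Ω) =
Y ∩ Ω with ℓ(τ) ≤ Σ_i ℓ(τ_i) + M(n−1) Since Md_M(Y, mod Ω^c) ≤ ℓ(τ) this gives the result."*  L7046–7049: *"With some
further analysis the bounds (keykey1), (keykey2), (otter) lead to the bound on the support of μ_Λ  |K(Y)| ≤ 𝒪(1)H_0
e^{−(κ − κ_0 − 2) d_M(Y, mod Ω^c)}  (simplon)"*.

**Why this module.**  TEMPLATE.md §4.2 row «D2 §3.14 cluster expansion with holes» was KERNEL BY NAME only (v8.74):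
the Mayer∕Ursell∕KP machinery of App. F is this lineage's abstract App. B kernel (`MayerExpansion`,
`ClusterActivityBound`, `UrsellTreeGraphBound`) with `supp X := X ∩ Ω`, and the row said *"NOT typed: (otter)∕(keykey1)∕
(keykey2) themselves (relative tree length …)"*.  Meanwhile the sibling `ThreeSortedResummation` (gen 15) built the
torus `d_M(·, mod Θ)` = `ThreeSorted.torusTreeLenMod` with its graph classes `ThreeSorted.TCover`∕`TAdmissibleMod` and
the join-through-a-common-cube `ThreeSorted.tCover_join_common`, `HoleSummability` (gen 16) proved (sumsum) =
`HoleSummability.sum_exp_torusTreeLenMod_le`, and `ResummationOperation` (part III App. B LEMMA 19) proved the volume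
step `card_sdiff_le_torusTreeLenMod` (= (keykey2)) and performs the (keykey1) summation inline inside
`ResummationOperation.abs_Bprime_le`.  On that carrier (otter) and a free-standing (keykey1) are one page each; this
module proves them, records (keykey2) by name, and then INSERTS all three into `ClusterActivityBound.norm_K_le` (whose
(clams)∕(sudsy)∕(ninety) hypotheses they are, for `supp X := X ∖ Θ`) — which is the *"further analysis"* of L7046 —
giving (simplon) on the torus with every geometric hypothesis discharged.

**What is reproduced here (kernel-checked, zero `sorry`).**
* Part 1 (otter): `coverLen_union_le_of_common` (target families `A`, `B` with a common cube `c ∈ S` and non-empty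
  classes: `coverLen S (A ∪ B) ≤ coverLen S A + coverLen S B + 1` — near-optimal graphs + `tCover_join_common`),
  `exists_tAdmissibleMod_union` ∕ **`torusTreeLenMod_union_le`** ((otter) for two Ω-connected polymers: `d_M(X₁ ∪ X₂,
  mod Θ) ≤ d_M(X₁, mod Θ) + d_M(X₂, mod Θ) + 1`), the printed notion **`OmegaConnected Θ D`** (*"cannot be divided into
  Ω-disjoint sets"*), `otter_induction` (the stitching induction), **`lemma_otter`** (for a non-empty Ω-connected
  finite family `D` with non-empty classes: `d_M(∪D, mod Θ) ≤ Σ_{X∈D} d_M(X, mod Θ) + (|D| − 1)`),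
  `exists_tAdmissibleMod_biUnion` (the stitched graph's class).
* Part 2 (keykey2) is the sibling's **`ResummationOperation.card_sdiff_le_torusTreeLenMod`** BY NAME (`|Y′ ∖ Θ| ≤
  2^d(4·d_M(Y′, mod Θ) + 1)`; part III App. B L2657–2659 prints the same sentence and that module proved it); added here
  only `lemma_keykey2'` (printed shape, `𝒪(1) = 4·2^d`) and `lemma_keykey2_dom` (torus localization domains: class
  automatic).
* Part 3 (keykey1): **`lemma_keykey1`** (for any finite family `𝒴` of polymers with holes and `κ ≥ κ₁(d)`: `Σ_{Y ∈ 𝒴: (Y ∩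
  Y′) ∖ Θ ≠ ∅} e^{−κ d_M(Y, mod Θ)} ≤ K₁(d)·|Y′ ∖ Θ|`, *"from (sumsum)"* = `sum_exp_torusTreeLenMod_le` summed over `□ ∈ Y′ ∖
  Θ`), `sum_omegaConnected_le` ((keykey1) ∘ (keykey2): `≤ K₁(d)·2^d(4·d_M(Y′, mod Θ) + 1)`).
* Part 4 (simplon): `biUnion_sdiff_eq_U` (`(∪T) ∖ Θ = ∪(X ∖ Θ)`, L7043), **`clams_of_mem_covers`** ((otter) ⟹ the App. B
  kernel's (clams) hypothesis for every connected cover `T ∈ MayerExpansion.covers (· ∖ Θ) Pol V` of an Ω-part `V`, with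
  `coverLen univ V ≤ d_M(∪T, mod Θ)`), **`sudsy_of_keykey1`** ((keykey1) ⟹ (sudsy): `Σ_{X∈Pol, X∖Θ ⊆ V} e^{−κ₀d_M(X, mod Θ)} ≤
  K₁(d)|V|`), **`ninety_of_keykey2`** ((keykey2) ⟹ (ninety): `|V| ≤ 4·2^d(1 + coverLen univ V)`), and **`simplon_torus`**:
  `‖K(V)‖ ≤ 2e·K₁(d)·κ₀·H₀·e^{−(κ−κ₀−2)·coverLen univ V}` for every Ω-part `V`, from `‖a X‖ ≤ 2H₀e^{−κd_M(X, mod Θ)}`,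
  `max(κ₁(d), 4·2^d) ≤ κ₀ ≤ κ`, `0 ≤ H₀ ≤ c₀`, `2c₀K₁(d)κ₀e^{κ−κ₀} ≤ 1` — `ClusterActivityBound.norm_K_le` with its three
  geometric hypotheses DISCHARGED.
* Part 5: non-vacuity (`omegaConnected_singleton`, `omegaConnected_pair`, the one-member instance of `lemma_otter` on
  every torus).
* Bridge: **`omegaConnected_iff_isConnColl`** (Ω-connected = `MayerExpansion.IsConnColl (MayerExpansion.Overlap (· ∖ Θ))`,
  the App. B kernel's connectedness for the support map `supp X := X ∖ Θ`), `lemma_otter_of_isConnColl`.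

**Readings / located items (declared).**  (i) CARRIER: the torus polymer model of `TreeLengthTorus`∕
`ThreeSortedResummation` (unit cubes, `M = 1`, sup metric, graphs in the universal cover — conventions D-pv22.1 ∕
D-pv22g2.1 of the cell); `Y ∩ Ω` is `Y ∖ Θ` with `Θ` the family of cubes of the holes `Ω^c`; Ω-connected = a common
cube outside `Θ`.  (ii) (otter) is proved for families with NON-EMPTY CLASSES (`∃ T, TAdmissibleMod X Θ T`; automatic
for torus localization domains, `ThreeSorted.exists_tCover_of_dom`) — the print's *"minimal graphs"* are replaced by
ε-near-optimal graphs (the infimum need not be attained; immaterial).  The `𝒟_k(mod Ω^c)` membership (`ThreeSorted.DMod`)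
is NOT needed for (otter)∕(keykey2) and enters (keykey1) only through (sumsum)'s index set.  (iii) CONSTANTS: the
print's `𝒪(1)` are displayed — `2^d(4·d + 1)` in (keykey2) (the sibling's, from App. E Lemma E.1 (3)), `K₁(d)` of
`HoleSummability` in (keykey1) for `κ ≥ κ₁(d)` (the print's `κ_0`); not optimal.  (v) (keykey1) as a free-standing
lemma over an arbitrary finite family `𝒴` is the same computation as the step `hsum` inside
`ResummationOperation.abs_Bprime_le` (there tied to the fibre of the adjoining map); stated here once in the shape App. F
uses.  (iv) The unordered printed form of
(otter) (*"{X_i} has n elements"*, a SET of distinct polymers) is `lemma_otter` over a `Finset`; the stitching order is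
produced inside `otter_induction` from Ω-connectedness (no spanning tree is chosen explicitly — at each step some
outside member is Ω-connected to the part already stitched, which is what *"cannot be divided into Ω-disjoint sets"*
gives).

**What is NOT claimed.**  THEOREM F.1 itself ((gog2), (sunshine): the exponentiation and the `H^#` bound — row «D2
§3.14»'s BY-NAME App. B kernel `MayerExpansion` §5 ∕ `UrsellTreeGraphBound` covers the combinatorial frame, the
measure-theoretic content is not typed); (simplon) in the print's own indexing by `Y` (reading (vi)); the activity input
`‖e^{H(X)} − 1‖ ≤ 2H₀e^{−κd}` (= `ClusterActivityBound.weight_le` from `|H(X)| ≤ H₀e^{−κd}`, kept as the hypothesis `ha`);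
(sumsum) and (keykey2) (imported: `HoleSummability`, `ResummationOperation`); LEMMA 3.18 `\label{cluster}` and the
(t,u)-interpolation of §3.14; anything of B1–B16 (the row's Bałaban side B13 §2, B16 §1 (1.90)–(1.98) untouched).  NOT
summit progress; NOT a statement about any Bałaban paper; NOT continuum; NOT Clay.  NEW leaf; imports
`…Dimock2011to13.ResummationOperation` (hence `HoleSummability`, `ThreeSortedResummation`, `TreeLengthTorusGeometry`, unit
b01's `B14RelTreeLength`) and `…Dimock2011to13.ClusterActivityBound` (hence `MayerExpansion`); no Summits import; no
cycle (neither chain imported the other); modifies nothing.  Unit `b2b-balaban-template` gen 36 rounds 6–7 (journal CLAIMs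
D2-KEYKEY-OTTER-KERNEL, D2-SIMPLON-KERNEL).

**Version.**  v1 (gen 36 round 6, p216555 ACCEPTED e3d40a5c0987).  v1.1 (gen 36, same seat, 2026-08-20) = DEDUP +
EXTENSION: the three (keykey2) declarations of v1 (`card_le_of_tCover`, `card_le_coverLen`, `lemma_keykey2`) are REMOVED
as duplicates of the sibling's earlier `ResummationOperation.card_le_of_tCover_len` ∕ `card_sdiff_le_torusTreeLenMod`
(part III App. B L2657–2659 prints (keykey2)'s sentence and that module proved it; (keykey2) is now used BY NAME — nothing
imported v1 yet, so no dependant is affected); every other v1 declaration keeps its name and statement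
(`lemma_keykey2_dom`, `sum_omegaConnected_le` re-proved through the sibling); ADDED the bridge
`omegaConnected_iff_isConnColl` ∕ `lemma_otter_of_isConnColl` to the App. B kernel's connectedness and Part 4 — (simplon)
on the torus by `ClusterActivityBound.norm_K_le` with (clams)∕(sudsy)∕(ninety) discharged (journal CLAIM
D2-SIMPLON-KERNEL).
-/

noncomputable section

open Real Finset
open Literature.MathematicalPhysics.QuantumFieldTheory.Balaban1983to89
open Literature.MathematicalPhysics.QuantumFieldTheory.Balaban1983to89.B13ScaleTransfer
open Literature.MathematicalPhysics.QuantumFieldTheory.Balaban1983to89.TreeLength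
open Literature.MathematicalPhysics.QuantumFieldTheory.Balaban1983to89.TreeLengthTorus
open Literature.MathematicalPhysics.QuantumFieldTheory.Balaban1983to89.TreeLengthTorusGeometry

namespace Literature.MathematicalPhysics.QuantumFieldTheory.Dimock2011to13.HolePolymerKeyBounds

open Literature.MathematicalPhysics.QuantumFieldTheory.Dimock2011to13.ThreeSorted
open Literature.MathematicalPhysics.QuantumFieldTheory.Dimock2011to13.HoleSummability
open Literature.MathematicalPhysics.QuantumFieldTheory.Dimock2011to13.ResummationOperation
  (card_le_of_tCover_len card_sdiff_le_torusTreeLenMod)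
open Literature.MathematicalPhysics.QuantumFieldTheory.Dimock2011to13.MayerExpansion
  (IsConnColl U covers K mem_covers isConnColl_iff_noSplit)
open Literature.MathematicalPhysics.QuantumFieldTheory.Dimock2011to13.ClusterActivityBound (norm_K_le)

variable {d N : ℕ}

/-! ## Part 1. (otter): stitching graphs through a common cube OUTSIDE the holes -/

/-- JOIN AT THE LEVEL OF THE INFIMA (target families): if the classes of graphs in `π⁻¹(S)` meeting `A` and meeting
`B` are non-empty and `A`, `B` have a common cube `c ∈ S`, then `coverLen S (A ∪ B) ≤ coverLen S A + coverLen S B + 1`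
— near-optimal graphs glued by ONE segment in the common lift of `c` (`ThreeSorted.tCover_join_common`), the step *"Stitch
together the τ_i"* of (otter)'s proof. [cite: Dimock2013BalabanII, App. F Theorem cluster3, proof eq. (otter) (arXiv:1212.5562v2 TeX L7037–7044)] -/
theorem coverLen_union_le_of_common {S A B : Finset (TPt d N)} (hA : ∃ T, TCover S A T) (hB : ∃ T, TCover S B T)
    {c : TPt d N} (hcA : c ∈ A) (hcB : c ∈ B) (hcS : c ∈ S) :
    coverLen S (A ∪ B) ≤ coverLen S A + coverLen S B + 1 := by
  refine le_of_forall_pos_lt_add fun ε hε => ?_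
  obtain ⟨TA, hTA, hlA⟩ := exists_tCover_len_lt hA (half_pos hε)
  obtain ⟨TB, hTB, hlB⟩ := exists_tCover_len_lt hB (half_pos hε)
  obtain ⟨T, hT, hlen⟩ := tCover_join_common hTA hTB hcA hcB hcS
  rw [Finset.union_comm] at hT
  calc coverLen S (A ∪ B) ≤ len T := coverLen_le_len hT
    _ < coverLen S A + coverLen S B + 1 + ε := by linarith

/-- STITCHING TWO Ω-CONNECTED POLYMERS, the class: if `X₁` and `X₂` have graphs of the classes defining `d_M(X_i, mod Θ)`
and share a cube `c ∉ Θ` (they are *"Ω-connected"*, L7018–7019: *"X_1, X_2 ∈ 𝒟_k(mod Ω^c) are Ω-connected if X_1 ∩ Ω and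
X_2 ∩ Ω have non-empty intersection"*), then `X₁ ∪ X₂` has a graph of the class defining `d_M(X₁ ∪ X₂, mod Θ)`.
[cite: Dimock2013BalabanII, App. F Theorem cluster3, proof eq. (otter) (arXiv:1212.5562v2 TeX L7037–7044)] -/
theorem exists_tAdmissibleMod_union {X₁ X₂ Θ : Finset (TPt d N)} (h₁ : ∃ T, TAdmissibleMod X₁ Θ T)
    (h₂ : ∃ T, TAdmissibleMod X₂ Θ T) {c : TPt d N} (hc₁ : c ∈ X₁) (hc₂ : c ∈ X₂) (hcΘ : c ∉ Θ) :
    ∃ T, TAdmissibleMod (X₁ ∪ X₂) Θ T := by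
  obtain ⟨T₁, hT₁⟩ := h₁
  obtain ⟨T₂, hT₂⟩ := h₂
  have hT₁' : TCover (X₁ ∪ X₂) (X₁ \ Θ) T₁ := hT₁.mono Finset.subset_union_left (Finset.Subset.refl _)
  have hT₂' : TCover (X₁ ∪ X₂) (X₂ \ Θ) T₂ := hT₂.mono Finset.subset_union_right (Finset.Subset.refl _)
  obtain ⟨T, hT, -⟩ := tCover_join_common hT₁' hT₂' (Finset.mem_sdiff.2 ⟨hc₁, hcΘ⟩)
    (Finset.mem_sdiff.2 ⟨hc₂, hcΘ⟩) (Finset.mem_union_left _ hc₁)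
  refine ⟨T, hT.mono (Finset.Subset.refl _) ?_⟩
  intro a ha
  rw [Finset.mem_sdiff, Finset.mem_union] at ha
  rw [Finset.mem_union, Finset.mem_sdiff, Finset.mem_sdiff]
  tauto

/-- **(otter) FOR TWO POLYMERS**: if `X₁`, `X₂` (with non-empty classes) are Ω-connected through a cube `c ∉ Θ`, then
`d_M(X₁ ∪ X₂, mod Θ) ≤ d_M(X₁, mod Θ) + d_M(X₂, mod Θ) + 1` (`M = 1`): the graphs of `X_i` are graphs in the larger ambient
family `X₁ ∪ X₂` (`ThreeSorted.coverLen_mono`), `(X₁ ∪ X₂) ∖ Θ = (X₁ ∖ Θ) ∪ (X₂ ∖ Θ)` (L7043: *"∪_i (X_i ∩ Ω) = Y ∩ Ω"*), and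
`coverLen_union_le_of_common`. [cite: Dimock2013BalabanII, App. F Theorem cluster3, proof eq. (otter) (arXiv:1212.5562v2 TeX L7037–7044)] -/
theorem torusTreeLenMod_union_le {X₁ X₂ Θ : Finset (TPt d N)} (h₁ : ∃ T, TAdmissibleMod X₁ Θ T)
    (h₂ : ∃ T, TAdmissibleMod X₂ Θ T) {c : TPt d N} (hc₁ : c ∈ X₁) (hc₂ : c ∈ X₂) (hcΘ : c ∉ Θ) :
    torusTreeLenMod (X₁ ∪ X₂) Θ ≤ torusTreeLenMod X₁ Θ + torusTreeLenMod X₂ Θ + 1 := by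
  have hsd : (X₁ ∪ X₂) \ Θ = X₁ \ Θ ∪ X₂ \ Θ := by
    ext a
    rw [Finset.mem_sdiff, Finset.mem_union, Finset.mem_union, Finset.mem_sdiff, Finset.mem_sdiff]
    tauto
  have h₁' : ∃ T, TCover (X₁ ∪ X₂) (X₁ \ Θ) T := by
    obtain ⟨T, hT⟩ := h₁
    exact ⟨T, hT.mono Finset.subset_union_left (Finset.Subset.refl _)⟩
  have h₂' : ∃ T, TCover (X₁ ∪ X₂) (X₂ \ Θ) T := by
    obtain ⟨T, hT⟩ := h₂
    exact ⟨T, hT.mono Finset.subset_union_right (Finset.Subset.refl _)⟩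
  have hm₁ : coverLen (X₁ ∪ X₂) (X₁ \ Θ) ≤ torusTreeLenMod X₁ Θ :=
    coverLen_mono Finset.subset_union_left (Finset.Subset.refl _) h₁
  have hm₂ : coverLen (X₁ ∪ X₂) (X₂ \ Θ) ≤ torusTreeLenMod X₂ Θ :=
    coverLen_mono Finset.subset_union_right (Finset.Subset.refl _) h₂
  have hj := coverLen_union_le_of_common h₁' h₂' (Finset.mem_sdiff.2 ⟨hc₁, hcΘ⟩)
    (Finset.mem_sdiff.2 ⟨hc₂, hcΘ⟩) (Finset.mem_union_left _ hc₁)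
  rw [torusTreeLenMod_eq_coverLen, hsd]
  linarith

/-- **Ω-CONNECTED FAMILIES** — L7034, verbatim: *"The latter sum is restricted by the condition that the X_i are
Ω-connected, i.e. cannot be divided into Ω-disjoint sets"* (with L7018–7021: *"X_1, X_2 … are Ω-connected if … X_1 ∩ X_2 ∩ Ω
≠ ∅. Otherwise … they are called Ω-disjoint"*): a finite family `D` of polymers is Ω-connected (holes `Θ` = the cubes
of Ω^c) iff no proper non-empty subfamily is Ω-disjoint from the rest, i.e. every proper non-empty `G ⊂ D` has a member
sharing a cube outside `Θ` with a member of `D ∖ G`. [cite: Dimock2013BalabanII, App. F Theorem cluster3, proof (arXiv:1212.5562v2 TeX L7016–7034)] -/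
def OmegaConnected (Θ : Finset (TPt d N)) (D : Finset (Finset (TPt d N))) : Prop :=
  ∀ G ⊆ D, G.Nonempty → G ≠ D → ∃ X ∈ G, ∃ X' ∈ D, X' ∉ G ∧ ∃ c ∈ X, c ∈ X' ∧ c ∉ Θ

/-- Unfolding of `OmegaConnected` (the printed *"cannot be divided into Ω-disjoint sets"*). [cite: Dimock2013BalabanII, App. F Theorem cluster3, proof (arXiv:1212.5562v2 TeX L7016–7034)] -/
theorem omegaConnected_iff {Θ : Finset (TPt d N)} {D : Finset (Finset (TPt d N))} :
    OmegaConnected Θ D ↔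
      ∀ G ⊆ D, G.Nonempty → G ≠ D → ∃ X ∈ G, ∃ X' ∈ D, X' ∉ G ∧ ∃ c ∈ X, c ∈ X' ∧ c ∉ Θ :=
  Iff.rfl

/-- A one-member family `{X}` is Ω-connected (vacuously: it has no proper non-empty subfamily) — the `n = 1` case of
(otter)'s index set. [cite: Dimock2013BalabanII, App. F Theorem cluster3, proof (arXiv:1212.5562v2 TeX L7016–7034)] -/
theorem omegaConnected_singleton (Θ X : Finset (TPt d N)) : OmegaConnected Θ {X} := by
  intro G hG hGne hGD
  exact absurd (Finset.Subset.antisymm hG (Finset.singleton_subset_iff.2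
    (by obtain ⟨Y, hY⟩ := hGne; rwa [Finset.mem_singleton.1 (hG hY)] at hY))) hGD

/-- **Ω-connected = connected for the overlap of Ω-parts**: for a non-empty family, `OmegaConnected Θ D` IS the App. B
kernel's `MayerExpansion.IsConnColl (MayerExpansion.Overlap (· ∖ Θ)) D` (Dimock's *"cannot be divided into two disjoint sets"*,
`MayerExpansion.isConnColl_iff_noSplit`) for the support map `supp X := X ∖ Θ` — the typed form of L7005–7006 *"instead of
general polymers X, we have polymers X ∈ 𝒟_k(mod Ω^c) with holes"* under which App. F reuses App. B of part I.
[cite: Dimock2013BalabanII, App. F Theorem cluster3, proof (arXiv:1212.5562v2 TeX L7004–7034)] -/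
theorem omegaConnected_iff_isConnColl {Θ : Finset (TPt d N)} {D : Finset (Finset (TPt d N))} (hD : D.Nonempty) :
    OmegaConnected Θ D ↔ IsConnColl (MayerExpansion.Overlap fun X : Finset (TPt d N) => X \ Θ) D := by
  rw [isConnColl_iff_noSplit (ov := MayerExpansion.Overlap fun X : Finset (TPt d N) => X \ Θ) hD]
  constructor
  · intro h G hG hne hneq
    obtain ⟨X, hX, X', hX'D, hX'G, c, hcX, hcX', hcΘ⟩ := h G hG hne hneq
    exact ⟨X, hX, X', Finset.mem_sdiff.2 ⟨hX'D, hX'G⟩, c,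
      Finset.mem_inter.2 ⟨Finset.mem_sdiff.2 ⟨hcX, hcΘ⟩, Finset.mem_sdiff.2 ⟨hcX', hcΘ⟩⟩⟩
  · intro h G hG hne hneq
    obtain ⟨X, hX, X', hX', c, hc⟩ := h G hG hne hneq
    rw [Finset.mem_inter, Finset.mem_sdiff, Finset.mem_sdiff] at hc
    exact ⟨X, hX, X', (Finset.mem_sdiff.1 hX').1, (Finset.mem_sdiff.1 hX').2, c, hc.1.1, hc.2.1, hc.1.2⟩

/-- THE STITCHING INDUCTION behind (otter) (L7041–7044: *"let τ_i be minimal graphs on the cubes in X_i ∩ Ω … Stitch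
together the τ_i to get a graph τ on the cubes in ∪_i (X_i ∩ Ω) = Y ∩ Ω with ℓ(τ) ≤ Σ_i ℓ(τ_i) + M(n−1)"*): growing an
Ω-connected family one Ω-connected member at a time, the class stays non-empty and the bound `d_M(∪G, mod Θ) ≤ Σ_{X∈G}
d_M(X, mod Θ) + (|G| − 1)` propagates from `G` to `D` (induction on `|D ∖ G|`, one `torusTreeLenMod_union_le` per step).
[cite: Dimock2013BalabanII, App. F Theorem cluster3, proof eq. (otter) (arXiv:1212.5562v2 TeX L7037–7044)] -/
theorem otter_induction (Θ : Finset (TPt d N)) {D : Finset (Finset (TPt d N))}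
    (hcl : ∀ X ∈ D, ∃ T, TAdmissibleMod X Θ T) (hD : OmegaConnected Θ D) :
    ∀ n : ℕ, ∀ G : Finset (Finset (TPt d N)), G ⊆ D → G.Nonempty → (D \ G).card = n →
      ((∃ T, TAdmissibleMod (G.biUnion id) Θ T) ∧
        torusTreeLenMod (G.biUnion id) Θ ≤ ∑ X ∈ G, torusTreeLenMod X Θ + ((G.card : ℝ) - 1)) →
      (∃ T, TAdmissibleMod (D.biUnion id) Θ T) ∧
        torusTreeLenMod (D.biUnion id) Θ ≤ ∑ X ∈ D, torusTreeLenMod X Θ + ((D.card : ℝ) - 1) := by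
  classical
  intro n
  induction n with
  | zero =>
    intro G hGD _ hcard hG
    have hGeq : G = D :=
      Finset.Subset.antisymm hGD (Finset.sdiff_eq_empty_iff_subset.1 (Finset.card_eq_zero.1 hcard))
    subst hGeq
    exact hG
  | succ n ih =>
    intro G hGD hGne hcard hG
    obtain ⟨hGcl, hGle⟩ := hG
    have hGneD : G ≠ D := by
      intro h
      rw [h, Finset.sdiff_self, Finset.card_empty] at hcard
      exact Nat.succ_ne_zero n hcard.symm
    obtain ⟨X, hXG, X', hX'D, hX'G, c, hcX, hcX', hcΘ⟩ := hD G hGD hGne hGneD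
    have hcU : c ∈ G.biUnion id := Finset.mem_biUnion.2 ⟨X, hXG, hcX⟩
    have hcl' := exists_tAdmissibleMod_union (hcl X' hX'D) hGcl hcX' hcU hcΘ
    have hle' := torusTreeLenMod_union_le (hcl X' hX'D) hGcl hcX' hcU hcΘ
    have hsub : insert X' G ⊆ D := Finset.insert_subset hX'D hGD
    have hcard' : (D \ insert X' G).card = n := by
      rw [Finset.sdiff_insert, Finset.card_erase_of_mem (Finset.mem_sdiff.2 ⟨hX'D, hX'G⟩), hcard]
      simp
    refine ih (insert X' G) hsub (Finset.insert_nonempty _ _) hcard' ⟨?_, ?_⟩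
    · rw [Finset.biUnion_insert]
      exact hcl'
    · rw [Finset.biUnion_insert, Finset.sum_insert hX'G, Finset.card_insert_of_notMem hX'G]
      change torusTreeLenMod (X' ∪ G.biUnion id) Θ ≤ _
      push_cast
      linarith

/-- **(otter)** — [Dimock2013BalabanII] App. F, verbatim (L7037–7040): *"To estimate K(Y) we need to show that if {X_i} has n
elements  d_M(Y, mod Ω^c) ≤ Σ_i d_M(X_i, mod Ω^c) + (n−1)"* (`Y = ∪_i X_i`, the `X_i` Ω-connected, L7032–7034), PROVED for
the torus `d_M(·, mod Θ) = ThreeSorted.torusTreeLenMod · Θ` (`M = 1`): for a non-empty Ω-connected finite family `D` of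
polymers whose classes are non-empty, `d_M(∪D, mod Θ) ≤ Σ_{X∈D} d_M(X, mod Θ) + (|D| − 1)`; printed proof L7041–7044 =
`otter_induction` started from one member. [cite: Dimock2013BalabanII, App. F Theorem cluster3, proof eq. (otter) (arXiv:1212.5562v2 TeX L7037–7044)] -/
theorem lemma_otter (Θ : Finset (TPt d N)) {D : Finset (Finset (TPt d N))} (hDne : D.Nonempty)
    (hcl : ∀ X ∈ D, ∃ T, TAdmissibleMod X Θ T) (hD : OmegaConnected Θ D) :
    torusTreeLenMod (D.biUnion id) Θ ≤ ∑ X ∈ D, torusTreeLenMod X Θ + ((D.card : ℝ) - 1) := by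
  classical
  obtain ⟨X₁, hX₁⟩ := hDne
  refine (otter_induction Θ hcl hD _ {X₁} (Finset.singleton_subset_iff.2 hX₁) (Finset.singleton_nonempty _) rfl
    ⟨?_, ?_⟩).2
  · rw [Finset.singleton_biUnion]
    exact hcl X₁ hX₁
  · simp

/-- (otter) also yields the CLASS of the union: an Ω-connected family of polymers with non-empty classes has a graph of the
class defining `d_M(∪D, mod Θ)` (the stitched graph τ of L7042–7043). [cite: Dimock2013BalabanII, App. F Theorem cluster3, proof eq. (otter) (arXiv:1212.5562v2 TeX L7041–7044)] -/
theorem exists_tAdmissibleMod_biUnion (Θ : Finset (TPt d N)) {D : Finset (Finset (TPt d N))} (hDne : D.Nonempty)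
    (hcl : ∀ X ∈ D, ∃ T, TAdmissibleMod X Θ T) (hD : OmegaConnected Θ D) :
    ∃ T, TAdmissibleMod (D.biUnion id) Θ T := by
  classical
  obtain ⟨X₁, hX₁⟩ := hDne
  refine (otter_induction Θ hcl hD _ {X₁} (Finset.singleton_subset_iff.2 hX₁) (Finset.singleton_nonempty _) rfl
    ⟨?_, ?_⟩).1
  · rw [Finset.singleton_biUnion]
    exact hcl X₁ hX₁
  · simp

/-- (otter) for a CONNECTED COVER in the App. B kernel's sense (`MayerExpansion.IsConnColl (Overlap (· ∖ Θ)) T` — the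
index condition of `MayerExpansion.covers`∕`K` with `supp X := X ∖ Θ`): `d_M(∪T, mod Θ) ≤ Σ_{X∈T} d_M(X, mod Θ) + (|T| − 1)`.
[cite: Dimock2013BalabanII, App. F Theorem cluster3, proof eq. (otter) (arXiv:1212.5562v2 TeX L7037–7044)] -/
theorem lemma_otter_of_isConnColl (Θ : Finset (TPt d N)) {T : Finset (Finset (TPt d N))}
    (hcl : ∀ X ∈ T, ∃ G, TAdmissibleMod X Θ G) (hT : IsConnColl (MayerExpansion.Overlap fun X : Finset (TPt d N) => X \ Θ) T) :
    torusTreeLenMod (T.biUnion id) Θ ≤ ∑ X ∈ T, torusTreeLenMod X Θ + ((T.card : ℝ) - 1) :=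
  lemma_otter Θ hT.1 hcl ((omegaConnected_iff_isConnColl hT.1).2 hT)

/-! ## Part 2. (keykey2): the volume of `Y′ ∩ Ω` is controlled by `d_M(Y′, mod Ω^c)` — BY NAME

(keykey2) — [Dimock2013BalabanII] App. F, verbatim (L7011–7014): *"and the bound  |Y′ ∩ Ω|_M ≤ 𝒪(1)(d_M(Y′, mod Ω^c) + 1)"* —
is the same sentence as [Dimock2013BalabanIII] App. B L2657–2659 (*"|Y ∩ Λ|_M ≤ 𝒪(1)(d_M(Y ∩ Λ) + 1) = 𝒪(1)(d_M(Y, mod Λᶜ)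
+ 1)"*), PROVED for the torus `d_M(·, mod Θ)` in the sibling `ResummationOperation` (Part 3): it IS
**`ResummationOperation.card_sdiff_le_torusTreeLenMod` (hne : ∃ T, TCover Y (Y ∖ Θ) T) : |Y ∖ Θ| ≤ 2^d(4·d_M(Y, mod Θ) +
1)** (with `ResummationOperation.card_le_of_tCover_len` — `|B| ≤ 2^d(4·len T + 1)` for a graph in `π⁻¹(S)` meeting `B`, App.
E LEMMA E.1 (3) — and `card_sdiff_le_exp`), used below BY NAME; only the printed `𝒪(1)`-shape and the localization-domain
corollary are added. -/

/-- (keykey2) in the printed shape `|Y′ ∩ Ω|_M ≤ 𝒪(1)(d_M(Y′, mod Ω^c) + 1)` with `𝒪(1) = 4·2^d`, from the sibling's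
`ResummationOperation.card_sdiff_le_torusTreeLenMod` (`|Y′ ∖ Θ| ≤ 2^d(4·d_M + 1)`), whenever the class of `Y′` is non-empty.
[cite: Dimock2013BalabanII, App. F Theorem cluster3, proof eq. (keykey2) (arXiv:1212.5562v2 TeX L7011–7014)] -/
theorem lemma_keykey2' {Y Θ : Finset (TPt d N)} (hne : ∃ T, TAdmissibleMod Y Θ T) :
    ((Y \ Θ).card : ℝ) ≤ 4 * 2 ^ d * (torusTreeLenMod Y Θ + 1) := by
  have h := card_sdiff_le_torusTreeLenMod hne
  have h2d : (0 : ℝ) ≤ 2 ^ d := by positivity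
  nlinarith [torusTreeLenMod_nonneg Y Θ]

section Periodic

variable [NeZero N]

/-- (keykey2) for a torus localization domain `Y′` (non-empty, face-connected): its class is automatically non-empty
(`ThreeSorted.exists_tCover_of_dom`), so `ResummationOperation.card_sdiff_le_torusTreeLenMod` applies unconditionally. [cite: Dimock2013BalabanII, App. F Theorem cluster3, proof eq. (keykey2) (arXiv:1212.5562v2 TeX L7011–7014)] -/
theorem lemma_keykey2_dom {Y : Finset (TPt d N)} (hY : Y.Nonempty) (hc : TFaceConnected Y) (Θ : Finset (TPt d N)) :
    ((Y \ Θ).card : ℝ) ≤ 2 ^ d * (4 * torusTreeLenMod Y Θ + 1) :=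
  card_sdiff_le_torusTreeLenMod (exists_tCover_of_dom hY hc (Finset.Subset.refl Y) Finset.sdiff_subset)

/-! ## Part 3. (keykey1): the polymers Ω-connected to `Y′` are summable against `|Y′ ∩ Ω|` -/

/-- **(keykey1)** — [Dimock2013BalabanII] App. F, verbatim (L7007–7011): *"Key ingredients are the bound  Σ_{Y: Y ∩ Y′ ∩ Ω ≠ ∅}
e^{−κ_0 d_M(Y, mod Ω^c)} ≤ 𝒪(1)|Y′ ∩ Ω|_M  from (sumsum)"*, PROVED for the torus `d_M(·, mod Θ)` from the kernel (sumsum)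
= `HoleSummability.sum_exp_torusTreeLenMod_le` (App. E Lemma E.3, every dimension): for any finite family `𝒴` of polymers
with holes (non-empty, face-connected, `DMod Θ Y`) and `κ ≥ κ₁(d)`, the sub-sum over the members Ω-connected to `Y′` is `≤
K₁(d)·|Y′ ∖ Θ|` — route L7011 *"from (sumsum)"*: every such `Y` contains a cube `□ ∈ Y′ ∖ Θ`, so the sum is at most `Σ_{□ ∈
Y′ ∖ Θ} Σ_{Y ∋ □}` (`ThreeSorted.sum_le_sum_sum_of_cover`), each inner sum `≤ K₁(d)`.
[cite: Dimock2013BalabanII, App. F Theorem cluster3, proof eq. (keykey1) (arXiv:1212.5562v2 TeX L7007–7011)] -/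
theorem lemma_keykey1 (Θ Y' : Finset (TPt d N)) (𝒴 : Finset (Finset (TPt d N)))
    (h𝒴 : ∀ Y ∈ 𝒴, Y.Nonempty ∧ TFaceConnected Y ∧ DMod Θ Y) {κ : ℝ} (hκ : kappa₁ d ≤ κ) :
    ∑ Y ∈ 𝒴 with ((Y ∩ Y') \ Θ).Nonempty, Real.exp (-κ * torusTreeLenMod Y Θ) ≤
      K₁ d * ((Y' \ Θ).card : ℝ) := by
  classical
  set P := 𝒴.filter fun Y => ((Y ∩ Y') \ Θ).Nonempty with hP
  set Q : TPt d N → Finset (Finset (TPt d N)) := fun c => 𝒴.filter fun Y => c ∈ Y with hQ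
  have hcov : ∀ Y ∈ P, ∃ c ∈ Y' \ Θ, Y ∈ Q c := by
    intro Y hY
    rw [hP, Finset.mem_filter] at hY
    obtain ⟨hY𝒴, c, hc⟩ := hY
    rw [Finset.mem_sdiff, Finset.mem_inter] at hc
    exact ⟨c, Finset.mem_sdiff.2 ⟨hc.1.2, hc.2⟩, Finset.mem_filter.2 ⟨hY𝒴, hc.1.1⟩⟩
  have h1 := sum_le_sum_sum_of_cover P (Y' \ Θ) Q (fun Y => Real.exp (-κ * torusTreeLenMod Y Θ))
    (fun Y => (Real.exp_pos _).le) hcov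
  have h2 : ∀ c ∈ Y' \ Θ, ∑ Y ∈ Q c, Real.exp (-κ * torusTreeLenMod Y Θ) ≤ K₁ d := by
    intro c hc
    refine sum_exp_torusTreeLenMod_le Θ (Finset.mem_sdiff.1 hc).2 (Q c) (fun Y hY => ?_) hκ
    rw [hQ, Finset.mem_filter] at hY
    obtain ⟨h1, h2, h3⟩ := h𝒴 Y hY.1
    exact ⟨h1, h2, hY.2, h3⟩
  calc ∑ Y ∈ P, Real.exp (-κ * torusTreeLenMod Y Θ)
      ≤ ∑ c ∈ Y' \ Θ, ∑ Y ∈ Q c, Real.exp (-κ * torusTreeLenMod Y Θ) := h1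
    _ ≤ ∑ c ∈ Y' \ Θ, K₁ d := Finset.sum_le_sum h2
    _ = K₁ d * ((Y' \ Θ).card : ℝ) := by rw [Finset.sum_const, nsmul_eq_mul, mul_comm]

/-- (keykey1) ∘ (keykey2) — the combination used in the *"further analysis"* towards (simplon) L7046–7049: the polymers
Ω-connected to a polymer `Y′` (with non-empty class) are summable against `d_M(Y′, mod Θ)`: `Σ_{Y: Y ∩ Y′ ∩ Ω ≠ ∅} e^{−κ
d_M(Y, mod Θ)} ≤ K₁(d)·2^d(4·d_M(Y′, mod Θ) + 1)`. [cite: Dimock2013BalabanII, App. F Theorem cluster3, proof eqs. (keykey1)–(keykey2) (arXiv:1212.5562v2 TeX L7007–7014, L7046–7049)] -/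
theorem sum_omegaConnected_le (Θ : Finset (TPt d N)) {Y' : Finset (TPt d N)} (hne : ∃ T, TAdmissibleMod Y' Θ T)
    (𝒴 : Finset (Finset (TPt d N))) (h𝒴 : ∀ Y ∈ 𝒴, Y.Nonempty ∧ TFaceConnected Y ∧ DMod Θ Y) {κ : ℝ}
    (hκ : kappa₁ d ≤ κ) :
    ∑ Y ∈ 𝒴 with ((Y ∩ Y') \ Θ).Nonempty, Real.exp (-κ * torusTreeLenMod Y Θ) ≤
      K₁ d * (2 ^ d * (4 * torusTreeLenMod Y' Θ + 1)) :=
  (lemma_keykey1 Θ Y' 𝒴 h𝒴 hκ).trans (mul_le_mul_of_nonneg_left (card_sdiff_le_torusTreeLenMod hne) (K₁_pos d).le)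

end Periodic

/-! ## Part 4. (simplon) on the torus: the three ingredients inserted into the App. B kernel `ClusterActivityBound.norm_K_le` -/

section Simplon

variable [NeZero N]

omit [NeZero N] in
/-- The Ω-part of a union is the union of the Ω-parts: `(∪T) ∖ Θ = ∪_{X∈T}(X ∖ Θ)` (L7043 *"∪_i (X_i ∩ Ω) = Y ∩ Ω"*).
[cite: Dimock2013BalabanII, App. F Theorem cluster3, proof eq. (otter) (arXiv:1212.5562v2 TeX L7041–7044)] -/
theorem biUnion_sdiff_eq_U (Θ : Finset (TPt d N)) (T : Finset (Finset (TPt d N))) :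
    T.biUnion id \ Θ = U (fun X : Finset (TPt d N) => X \ Θ) T := by
  ext a
  simp only [U, Finset.mem_sdiff, Finset.mem_biUnion, id]
  constructor
  · rintro ⟨⟨X, hX, ha⟩, hΘ⟩
    exact ⟨X, hX, ha, hΘ⟩
  · rintro ⟨X, hX, ha, hΘ⟩
    exact ⟨⟨X, hX, ha⟩, hΘ⟩

/-- (otter) delivers the App. B kernel's hypothesis (clams) for the connected covers of an Ω-part `V`, with the decay length
of `V` read as its torus Steiner length `coverLen univ V` (graphs anywhere in the cover meeting every cube of `V`): for `T ∈
covers (· ∖ Θ) Pol V`, `coverLen univ V ≤ d_M(∪T, mod Θ) ≤ Σ_{X∈T} d_M(X, mod Θ) + (|T| − 1)`.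
[cite: Dimock2013BalabanII, App. F Theorem cluster3, proof eq. (otter) (arXiv:1212.5562v2 TeX L7037–7049)] -/
theorem clams_of_mem_covers (Θ : Finset (TPt d N)) {Pol : Finset (Finset (TPt d N))}
    (hPol : ∀ X ∈ Pol, X.Nonempty ∧ TFaceConnected X) {V : Finset (TPt d N)} {T : Finset (Finset (TPt d N))}
    (hT : T ∈ covers (fun X : Finset (TPt d N) => X \ Θ) Pol V) :
    coverLen Finset.univ V ≤ ∑ X ∈ T, torusTreeLenMod X Θ + 1 * ((T.card : ℝ) - 1) := by
  obtain ⟨hTP, hconn, hU⟩ := mem_covers.1 hT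
  have hcl : ∀ X ∈ T, ∃ G, TAdmissibleMod X Θ G := fun X hX => by
    obtain ⟨h1, h2⟩ := hPol X (hTP hX)
    exact exists_tCover_of_dom h1 h2 (Finset.Subset.refl X) Finset.sdiff_subset
  have h1 := lemma_otter_of_isConnColl Θ hcl hconn
  have hcls := exists_tAdmissibleMod_biUnion Θ hconn.1 hcl ((omegaConnected_iff_isConnColl hconn.1).2 hconn)
  have h2 : coverLen Finset.univ V ≤ torusTreeLenMod (T.biUnion id) Θ := by
    rw [torusTreeLenMod_eq_coverLen, biUnion_sdiff_eq_U, hU]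
    rw [← hU, ← biUnion_sdiff_eq_U]
    exact coverLen_mono (Finset.subset_univ _) (Finset.Subset.refl _) hcls
  linarith

/-- (keykey1) delivers the App. B kernel's hypothesis (sudsy) for Ω-parts: the polymers of `Pol` (each with a non-empty
Ω-part, in `𝒟_k(mod Θ)`) whose Ω-part lies inside `V` are summable against `|V|`: `Σ_{X ∈ Pol, X ∖ Θ ⊆ V} e^{−κ₀ d_M(X, mod
Θ)} ≤ K₁(d)·|V|` (`κ₀ ≥ κ₁(d)`). [cite: Dimock2013BalabanII, App. F Theorem cluster3, proof eq. (keykey1) (arXiv:1212.5562v2 TeX L7007–7011, L7046–7049)] -/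
theorem sudsy_of_keykey1 (Θ : Finset (TPt d N)) {Pol : Finset (Finset (TPt d N))}
    (hPol : ∀ X ∈ Pol, X.Nonempty ∧ TFaceConnected X ∧ DMod Θ X ∧ (X \ Θ).Nonempty) (V : Finset (TPt d N))
    {κ₀ : ℝ} (hκ₀ : kappa₁ d ≤ κ₀) :
    ∑ X ∈ Pol with X \ Θ ⊆ V, Real.exp (-κ₀ * torusTreeLenMod X Θ) ≤ K₁ d * (V.card : ℝ) := by
  classical
  have hsub : (Pol.filter fun X => X \ Θ ⊆ V) ⊆ Pol.filter fun X => ((X ∩ V) \ Θ).Nonempty := by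
    intro X hX
    rw [Finset.mem_filter] at hX ⊢
    obtain ⟨hXP, hXV⟩ := hX
    obtain ⟨-, -, -, ⟨c, hc⟩⟩ := hPol X hXP
    refine ⟨hXP, c, ?_⟩
    rw [Finset.mem_sdiff, Finset.mem_inter]
    exact ⟨⟨(Finset.mem_sdiff.1 hc).1, hXV hc⟩, (Finset.mem_sdiff.1 hc).2⟩
  have h1 := Finset.sum_le_sum_of_subset_of_nonneg hsub
    (f := fun X => Real.exp (-κ₀ * torusTreeLenMod X Θ)) (fun X _ _ => (Real.exp_pos _).le)
  have h2 := lemma_keykey1 Θ V Pol (fun X hX => let h := hPol X hX; ⟨h.1, h.2.1, h.2.2.1⟩) hκ₀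
  have h3 : ((V \ Θ).card : ℝ) ≤ V.card := by exact_mod_cast Finset.card_le_card Finset.sdiff_subset
  exact h1.trans (h2.trans (mul_le_mul_of_nonneg_left h3 (K₁_pos d).le))

/-- (keykey2) delivers the App. B kernel's hypothesis (ninety) for an Ω-part `V` carrying a connected cover: `|V| ≤
4·2^d(1 + coverLen univ V)` (`ResummationOperation.card_le_of_tCover_len` under the infimum).
[cite: Dimock2013BalabanII, App. F Theorem cluster3, proof eq. (keykey2) (arXiv:1212.5562v2 TeX L7011–7014, L7046–7049)] -/
theorem ninety_of_keykey2 {V : Finset (TPt d N)} (hne : ∃ G, TCover Finset.univ V G) :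
    (V.card : ℝ) ≤ 4 * 2 ^ d * (1 + coverLen Finset.univ V) := by
  have h2d : (0 : ℝ) < 2 ^ d := by positivity
  have h : ((V.card : ℝ) / 2 ^ d - 1) / 4 ≤ coverLen Finset.univ V := by
    refine le_coverLen hne fun G hG => ?_
    have := card_le_of_tCover_len hG
    rw [div_le_iff₀ (by norm_num : (0 : ℝ) < 4), sub_le_iff_le_add, div_le_iff₀ h2d]
    linarith
  rw [div_le_iff₀ (by norm_num : (0 : ℝ) < 4), sub_le_iff_le_add, div_le_iff₀ h2d] at h
  nlinarith [coverLen_nonneg (Finset.univ : Finset (TPt d N)) V]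

/-- **(simplon) ON THE TORUS** — [Dimock2013BalabanII] App. F, verbatim (L7046–7049): *"With some further analysis the bounds
(keykey1), (keykey2), (otter) lead to the bound on the support of μ_Λ  |K(Y)| ≤ 𝒪(1)H_0 e^{−(κ − κ_0 − 2) d_M(Y, mod Ω^c)}"* —
the *"further analysis"* being part I App. B step 1, kernel `ClusterActivityBound.norm_K_le`; PROVED here by inserting the
three ingredients into that kernel with the support map `supp X := X ∖ Θ` (Ω-parts): for a finite family `Pol` of polymers
with holes (non-empty, face-connected, `DMod Θ X`, non-empty Ω-part), activities `‖a X‖ ≤ 2H₀e^{−κ d_M(X, mod Θ)}` on `Pol`,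
`max(κ₁(d), 4·2^d) ≤ κ₀ ≤ κ`, `0 ≤ H₀ ≤ c₀` and the smallness `2c₀K₁(d)κ₀e^{κ−κ₀} ≤ 1`: for EVERY Ω-part `V`,
`‖K(V)‖ = ‖Σ_{T ∈ covers} Π_{X∈T} a X‖ ≤ 2e·K₁(d)·κ₀·H₀·e^{−(κ−κ₀−2)·coverLen univ V}`.  READING (declared): the kernel's `K` is
indexed by the Ω-part `V = Y ∩ Ω` (`MayerExpansion.K`, TEMPLATE row «D2 §3.14» v8.74) and decays in its torus Steiner
length `coverLen univ V` (≤ `d_M(Y, mod Θ)` for every polymer `Y` with `Y ∖ Θ = V`); the print indexes by `Y`.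
[cite: Dimock2013BalabanII, App. F Theorem cluster3, proof eq. (simplon) (arXiv:1212.5562v2 TeX L7046–7049)] -/
theorem simplon_torus {𝕜 : Type*} [NormedField 𝕜] (Θ : Finset (TPt d N)) {Pol : Finset (Finset (TPt d N))}
    (hPol : ∀ X ∈ Pol, X.Nonempty ∧ TFaceConnected X ∧ DMod Θ X ∧ (X \ Θ).Nonempty)
    {a : Finset (TPt d N) → 𝕜} {κ κ₀ H₀ c₀ : ℝ} (hκ₁ : kappa₁ d ≤ κ₀) (hκv : 4 * 2 ^ d ≤ κ₀) (hκ : κ₀ ≤ κ)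
    (hH₀ : 0 ≤ H₀) (hc₀ : H₀ ≤ c₀)
    (ha : ∀ X ∈ Pol, ‖a X‖ ≤ 2 * H₀ * Real.exp (-κ * torusTreeLenMod X Θ))
    (hsmall : 2 * c₀ * K₁ d * κ₀ * Real.exp (1 * (κ - κ₀)) ≤ 1) (V : Finset (TPt d N)) :
    ‖K (fun X : Finset (TPt d N) => X \ Θ) Pol (fun T => ∏ X ∈ T, a X) V‖ ≤
      2 * Real.exp 1 * K₁ d * κ₀ * H₀ * Real.exp (-(κ - κ₀ - 2) * coverLen Finset.univ V) := by
  classical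
  have hκ₀ : 0 ≤ κ₀ := le_trans (by positivity) hκv
  by_cases hcov : covers (fun X : Finset (TPt d N) => X \ Θ) Pol V = ∅
  · -- no connected cover: `K(V) = 0`
    unfold K
    rw [hcov, Finset.sum_empty, norm_zero]
    have := K₁_pos d
    positivity
  obtain ⟨T₀, hT₀⟩ := Finset.nonempty_iff_ne_empty.2 hcov
  -- a cover gives a graph meeting `V`: the class `(univ, V)` is non-empty
  have hne : ∃ G, TCover Finset.univ V G := by
    obtain ⟨hTP, hconn, hU⟩ := mem_covers.1 hT₀
    have hcl : ∀ X ∈ T₀, ∃ G, TAdmissibleMod X Θ G := fun X hX => by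
      obtain ⟨h1, h2, -, -⟩ := hPol X (hTP hX)
      exact exists_tCover_of_dom h1 h2 (Finset.Subset.refl X) Finset.sdiff_subset
    obtain ⟨G, hG⟩ := exists_tAdmissibleMod_biUnion Θ hconn.1 hcl ((omegaConnected_iff_isConnColl hconn.1).2 hconn)
    refine ⟨G, ?_⟩
    have hG' : TCover Finset.univ (T₀.biUnion id \ Θ) G := hG.mono (Finset.subset_univ _) (Finset.Subset.refl _)
    rwa [biUnion_sdiff_eq_U, hU] at hG'
  refine norm_K_le hκ hH₀ (coverLen_nonneg _ _) (K₁_pos d).le hκ₀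
    (fun T hT => clams_of_mem_covers Θ (fun X hX => let h := hPol X hX; ⟨h.1, h.2.1⟩) hT)
    (fun X hX _ => ha X hX) (sudsy_of_keykey1 Θ hPol V hκ₁) ?_ hc₀ hsmall
  -- (ninety): |V| ≤ κ₀ (1 + coverLen univ V)
  have h := ninety_of_keykey2 hne
  have hc : 0 ≤ 1 + coverLen (Finset.univ : Finset (TPt d N)) V := by linarith [coverLen_nonneg (Finset.univ : Finset (TPt d N)) V]
  exact h.trans (mul_le_mul_of_nonneg_right hκv hc)

end Simplon

/-! ## Part 5. Non-vacuity -/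

/-- Non-vacuity of `OmegaConnected` beyond singletons: two polymers sharing a cube outside the holes (*"X_1 ∩ X_2 ∩ Ω ≠
∅"*, L7019) form an Ω-connected pair. [cite: Dimock2013BalabanII, App. F Theorem cluster3, proof (arXiv:1212.5562v2 TeX L7016–7021)] -/
theorem omegaConnected_pair {Θ X₁ X₂ : Finset (TPt d N)} {c : TPt d N} (hc₁ : c ∈ X₁) (hc₂ : c ∈ X₂) (hcΘ : c ∉ Θ) :
    OmegaConnected Θ {X₁, X₂} := by
  classical
  intro G hG hGne hGD
  by_cases h1 : X₁ ∈ G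
  · have h2 : X₂ ∉ G := by
      intro h2
      apply hGD
      refine Finset.Subset.antisymm hG ?_
      intro Y hY
      rcases Finset.mem_insert.1 hY with rfl | hY
      · exact h1
      · rwa [Finset.mem_singleton.1 hY]
    exact ⟨X₁, h1, X₂, by simp, h2, c, hc₁, hc₂, hcΘ⟩
  · obtain ⟨Y, hY⟩ := hGne
    have hY2 : Y = X₂ := by
      rcases Finset.mem_insert.1 (hG hY) with rfl | h
      · exact absurd hY h1
      · exact Finset.mem_singleton.1 h
    rw [hY2] at hY
    exact ⟨X₂, hY, X₁, by simp, h1, c, hc₂, hc₁, hcΘ⟩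

/-- Non-vacuity of `lemma_otter`'s hypotheses (classes + Ω-connectedness) on every torus: the one-member family of a
localization domain `Y` (its class is non-empty by `ThreeSorted.exists_tCover_of_dom`). [folklore] -/
example [NeZero N] {Y : Finset (TPt d N)} (hY : Y.Nonempty) (hc : TFaceConnected Y) (Θ : Finset (TPt d N)) :
    torusTreeLenMod (({Y} : Finset (Finset (TPt d N))).biUnion id) Θ ≤
      ∑ X ∈ ({Y} : Finset (Finset (TPt d N))), torusTreeLenMod X Θ +
        ((({Y} : Finset (Finset (TPt d N))).card : ℝ) - 1) :=
  lemma_otter Θ (Finset.singleton_nonempty Y)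
    (fun X hX => by
      rw [Finset.mem_singleton.1 hX]
      exact exists_tCover_of_dom hY hc (Finset.Subset.refl _) Finset.sdiff_subset)
    (omegaConnected_singleton Θ Y)

/-- A one-cube torus family is face-connected, so the previous example is inhabited on every torus (e.g. `Y = {a}`).
[folklore] -/
example (a : TPt d N) : TFaceConnected ({a} : Finset (TPt d N)) := by
  intro x hx y hy
  rw [Finset.mem_singleton] at hx hy
  rw [hx, hy]
  exact Relation.ReflTransGen.refl

end Literature.MathematicalPhysics.QuantumFieldTheory.Dimock2011to13.HolePolymerKeyBounds
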